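import Summits.AtomisticToContinuum.HydrodynamicLimit.Theorems.MourreKoopmanChargesStressStrongMixingStaticClusteringPinning
import Summits.AtomisticToContinuum.HydrodynamicLimit.Theorems.MourreKoopmanChargesStressStrongMixingGibbsMoments
import Literature.MathematicalPhysics.StatisticalMechanics.LowActivityHardSphereGibbsUniqueness
import HarnessLib

/-!
# `StressStrongMixing` · line `birth`, stub F3static `stub_staticClustering`, part 1b:
# exponential `φ`-mixing of the dilute hard-sphere DLR state (covariance bound from boundary-condition pinning)

Support file for the crux item stmt-AtomisticToContinuum-9584 (`StressStrongMixing`, route `MourreKoopmanCharges` of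
`AtomisticToContinuum/HydrodynamicLimit`), line `birth`, registered stub `stub_staticClustering` (F3static).

For a Gibbs state `μ` of the hard-sphere gas (`IsHardSphereGibbs σ z β u μ`, `16 z σ³ < 1`), the specification
`γ_Λ(·|Y)` of the ball `Λ = B(0, R)` (`KiferCompactification.gibbsSpecMeasure`, a measurable kernel with
`μ ∘ γ_Λ = μ` on functions) agrees on hard-core boundary conditions with the Poisson-form specification `hsLocalSpec`,
whose dependence on the boundary condition on events local in `B(0, k)`, `k + (d + 2)σ ≤ R`, is at most
`φ = 2 ν(B_k × ℝ³) e^{ν(B_k × ℝ³)} (16 z σ³)^d` (the tree's uniform pinning `abs_hsLocalSpec_toReal_sub_le`,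
Michelen–Perkins 2021 Thm 25 in DLR form; `gibbsSpecMeasure_setOf_lt_le_add`); observables measurable outside `Λ`
are frozen under `γ_Λ(·|Y)` (`lintegral_mul_comp_cylinder_gibbsSpecMeasure`, via `superposeIn`).  Feeding the
abstract lemma `abs_cov_le_of_pinning` (part 1a) gives `abs_cov_le_of_isHardSphereGibbs`: for `f` measurable,
bounded by `C` and local in `B(0, k)`, and `g ∈ L²(μ)` a measurable cylinder function of the complement of `B(0, R)`,

  `|Cov_μ(f, g)| ≤ 2 C φ ‖g‖_{L¹(μ)}`,

the exponential `φ`-mixing of the dilute hard-sphere gas between a ball and the complement of a larger ball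
(Ruelle 1969 §4.4 at the level of correlation functions; Spohn 1991 Part I Condition 2.1).

References: D. Ruelle, *Statistical Mechanics* (1969), §4.2 Thm 4.2.3, §4.4; M. Michelen, W. Perkins,
arXiv:2109.01094, Thm 3, Thm 25; H. Spohn, *Large Scale Dynamics of Interacting Particles* (1991), Part I
Condition 2.1.
-/

noncomputable section

open MeasureTheory ProbabilityTheory Filter Topology
open scoped ENNReal

namespace Summit.AtomisticToContinuum.HydrodynamicLimit.Theorems.MourreKoopmanChargesStressStrongMixing

open Literature.MathematicalPhysics.KineticTheory Literature.Analysis.FluidPDE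
open Literature.Analysis.FunctionSpaces (PointConfig maxwellianBeta)
open Literature.MathematicalPhysics.StatisticalMechanics (hsLocalSpec_eq_gibbsSpec smul_prod_uniqueness_hypotheses)
open Literature.MathematicalPhysics.StatisticalMechanics.HardSphere (window)
open Summit.AtomisticToContinuum.HydrodynamicLimit.Theorems.KiferCompactification (gibbsSpecMeasure
  gibbsSpecMeasure_apply lintegral_eq_lintegral_gibbsSpecMeasure lintegral_gibbsSpecMeasure
  lintegral_gibbsWeightMeasure measurable_superposeIn_left gibbsSpecMeasure_univ_le_one)

/-! ### Hard-sphere part: the specification of a ball, outside observables, pinning, `φ`-mixing -/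

section HardSphere

/-- **Outside observables are frozen under the specification**: if `g` is a cylinder function of the complement of
`Λ` (it does not see the particles thrown into `Λ`: `g (superposeIn Λ x Y) = g Y`), then for every measurable
`φ : ℝ → ℝ≥0∞` and `F ≥ 0`, `∫ F · φ(g) dγ_Λ(·|Y) = φ(g Y) ∫ F dγ_Λ(·|Y)`. [folklore] -/
theorem lintegral_mul_comp_cylinder_gibbsSpecMeasure (ε z β : ℝ) (u : V3) {Λ : Set V3} (hΛ : MeasurableSet Λ)
    {g : MarkedConfig → ℝ} (hgm : Measurable g)
    (hgcyl : ∀ (k : ℕ) (x : Fin k → V3 × V3) (Y : MarkedConfig), g (superposeIn Λ x Y) = g Y)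
    {φ : ℝ → ℝ≥0∞} (hφ : Measurable φ) (Y : MarkedConfig) {F : MarkedConfig → ℝ≥0∞} (hF : Measurable F) :
    ∫⁻ X, F X * φ (g X) ∂(gibbsSpecMeasure ε z β u Λ Y) = (∫⁻ X, F X ∂(gibbsSpecMeasure ε z β u Λ Y)) * φ (g Y) := by
  rw [lintegral_gibbsSpecMeasure, lintegral_gibbsSpecMeasure,
    lintegral_gibbsWeightMeasure ε z β u hΛ Y (F := fun X => F X * φ (g X)) (hF.mul (hφ.comp hgm)),
    lintegral_gibbsWeightMeasure ε z β u hΛ Y hF, mul_assoc, ← ENNReal.tsum_mul_right]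
  congr 1
  refine tsum_congr fun k => ?_
  rw [mul_assoc, ← lintegral_mul_const (φ (g Y))
    (show Measurable fun x : Fin k → V3 × V3 => F (superposeIn Λ x Y) from
      hF.comp (measurable_superposeIn_left hΛ k Y))]
  congr 1
  exact lintegral_congr fun x => by rw [hgcyl]

/-- **Uniform boundary-condition pinning for the series specification** (the tree's `abs_hsLocalSpec_toReal_sub_le`
transported through `hsLocalSpec = gibbsSpec` on hard-core boundary conditions): for `16 z σ³ < 1`, `Λ = B(0, R)`,
`k + (d + 2)σ ≤ R`, a measurable `f` local in `B(0, k)` (`f ∘ (·|_{B(0,k) × ℝ³}) = f`) and two hard-core boundary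
conditions `η, η'`, every superlevel set satisfies
`γ_Λ(η){t < f} ≤ γ_Λ(η'){t < f} + 2 ν(B_k × ℝ³) e^{ν(B_k × ℝ³)} (16 z σ³)^d`, `ν = z · Leb ⊗ M_β(· - u)`.
[cite: MichelenPerkins2021, Thm 25 and §5.1] -/
theorem gibbsSpecMeasure_setOf_lt_le_add {σ z β : ℝ} (hσ : 0 < σ) (hz : 0 ≤ z) (hzσ : 16 * (z * σ ^ 3) < 1)
    (hβ : 0 < β) (u : V3) {k R : ℝ} {d : ℕ} (hR : k + (d + 2) * σ ≤ R)
    {f : MarkedConfig → ℝ} (hfm : Measurable f)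
    (hfr : ∀ ω, f (PointConfig.restrict (window (Metric.ball (0 : V3) k)) ω) = f ω)
    {η η' : MarkedConfig} (hη : Literature.MathematicalPhysics.StatisticalMechanics.HardSphere.IsHardCore σ η)
    (hη' : Literature.MathematicalPhysics.StatisticalMechanics.HardSphere.IsHardCore σ η') (t : ℝ) :
    gibbsSpecMeasure σ z β u (Metric.ball 0 R) η {ω | t < f ω} ≤
      gibbsSpecMeasure σ z β u (Metric.ball 0 R) η' {ω | t < f ω} +
        ENNReal.ofReal (2 * ((Real.toNNReal z) • ((volume : Measure V3).prod ((volume : Measure V3).withDensity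
            fun v => ENNReal.ofReal (maxwellianBeta β (v - u))))).real (window (Metric.ball (0 : V3) k)) *
          Real.exp (((Real.toNNReal z) • ((volume : Measure V3).prod ((volume : Measure V3).withDensity
            fun v => ENNReal.ofReal (maxwellianBeta β (v - u))))).real (window (Metric.ball (0 : V3) k))) *
          (2 * (8 * (z * σ ^ 3))) ^ d) := by
  haveI := Literature.MathematicalPhysics.StatisticalMechanics.isProbabilityMeasure_withDensity_maxwellianBeta hβ u
  set M : Measure V3 := (volume : Measure V3).withDensity fun v => ENNReal.ofReal (maxwellianBeta β (v - u)) with hM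
  set ν : Measure (V3 × V3) := (Real.toNNReal z) • ((volume : Measure V3).prod M) with hν
  haveI : IsLocallyFiniteMeasure ν := by rw [hν]; infer_instance
  obtain ⟨h0, hm, hκ0, hκ, -, hfin⟩ := smul_prod_uniqueness_hypotheses hσ hz hzσ hβ u
  set Λ : Set V3 := Metric.ball 0 R with hΛdef
  have hΛ : MeasurableSet Λ := Metric.isOpen_ball.measurableSet
  have hb : Bornology.IsBounded Λ := Metric.isBounded_ball
  have hA' : MeasurableSet {ω : MarkedConfig | t < f ω} := measurableSet_lt measurable_const hfm
  have hwk : MeasurableSet (window (Metric.ball (0 : V3) k)) :=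
    Literature.MathematicalPhysics.StatisticalMechanics.HardSphere.measurableSet_window Metric.isOpen_ball.measurableSet
  have hset : {ω : MarkedConfig | t < f ω} =
      PointConfig.restrict (window (Metric.ball (0 : V3) k)) ⁻¹' {ω : MarkedConfig | t < f ω} := by
    ext ω
    simp only [Set.mem_setOf_eq, Set.mem_preimage, hfr]
  have hA : MeasurableSet (PointConfig.restrict (window (Metric.ball (0 : V3) k)) ⁻¹' {ω : MarkedConfig | t < f ω}) :=
    hA'.preimage (PointConfig.measurable_restrict hwk)
  have hbridge : ∀ {ξ : MarkedConfig}, Literature.MathematicalPhysics.StatisticalMechanics.HardSphere.IsHardCore σ ξ →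
      gibbsSpecMeasure σ z β u Λ ξ
          (PointConfig.restrict (window (Metric.ball (0 : V3) k)) ⁻¹' {ω : MarkedConfig | t < f ω}) =
        hsLocalSpec σ ν Λ ξ (PointConfig.restrict (window (Metric.ball (0 : V3) k)) ⁻¹' {ω : MarkedConfig | t < f ω}) :=
    fun hξ => by rw [gibbsSpecMeasure_apply σ z β u hΛ _ hA, hν, hM, hsLocalSpec_eq_gibbsSpec u hz hβ hΛ hb hξ hA]
  have hle1 : ∀ ξ : MarkedConfig, hsLocalSpec σ ν Λ ξ
      (PointConfig.restrict (window (Metric.ball (0 : V3) k)) ⁻¹' {ω : MarkedConfig | t < f ω}) ≠ ∞ := fun ξ =>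
    ne_top_of_le_ne_top ENNReal.one_ne_top ((measure_mono (Set.subset_univ _)).trans
      (hsLocalSpec_apply_univ_le_one σ ν Λ ξ))
  have hpin := abs_hsLocalSpec_toReal_sub_le ν hσ h0 hm hκ0 hκ hR (hfin R) (hη.restrict _) (hη'.restrict _) hA'
  rw [hset, hbridge hη, hbridge hη']
  set a := hsLocalSpec σ ν Λ η (PointConfig.restrict (window (Metric.ball (0 : V3) k)) ⁻¹' {ω : MarkedConfig | t < f ω})
  set b := hsLocalSpec σ ν Λ η' (PointConfig.restrict (window (Metric.ball (0 : V3) k)) ⁻¹' {ω : MarkedConfig | t < f ω})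
  have hab : a.toReal ≤ b.toReal + 2 * ν.real (window (Metric.ball (0 : V3) k)) *
      Real.exp (ν.real (window (Metric.ball (0 : V3) k))) * (2 * (8 * (z * σ ^ 3))) ^ d := by
    linarith [(abs_le.1 hpin).2]
  calc a = ENNReal.ofReal a.toReal := (ENNReal.ofReal_toReal (hle1 η)).symm
    _ ≤ ENNReal.ofReal (b.toReal + 2 * ν.real (window (Metric.ball (0 : V3) k)) *
          Real.exp (ν.real (window (Metric.ball (0 : V3) k))) * (2 * (8 * (z * σ ^ 3))) ^ d) :=
        ENNReal.ofReal_le_ofReal hab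
    _ ≤ ENNReal.ofReal b.toReal + ENNReal.ofReal (2 * ν.real (window (Metric.ball (0 : V3) k)) *
          Real.exp (ν.real (window (Metric.ball (0 : V3) k))) * (2 * (8 * (z * σ ^ 3))) ^ d) :=
        ENNReal.ofReal_add_le
    _ = _ := by rw [ENNReal.ofReal_toReal (hle1 η')]

/-- **Exponential `φ`-mixing of the dilute hard-sphere DLR state.**  Let `μ` be a Gibbs state of the hard-sphere gas
of diameter `σ > 0`, activity `z ≥ 0` with `16 z σ³ < 1`, inverse temperature `β > 0`, drift `u`.  For a measurable
observable `f` bounded by `C` and local in the ball `B(0, k)`, and a square-integrable measurable cylinder observable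
`g` of the complement of `B(0, R)`, `k + (d + 2)σ ≤ R`:
`|Cov_μ(f, g)| ≤ 2 C · (2 ν(B_k × ℝ³) e^{ν(B_k × ℝ³)} (16 z σ³)^d) · ‖g‖_{L¹(μ)}`, `ν = z · Leb ⊗ M_β(· - u)` —
uniform boundary-condition pinning of the specification of `B(0, R)` (Michelen–Perkins) and the DLR equations.
[cite: MichelenPerkins2021, Thm 3 and Thm 25] -/
theorem abs_cov_le_of_isHardSphereGibbs {σ z β : ℝ} (hσ : 0 < σ) (hz : 0 ≤ z) (hzσ : 16 * (z * σ ^ 3) < 1)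
    (hβ : 0 < β) {u : V3} {μ : Measure MarkedConfig} (hG : IsHardSphereGibbs σ z β u μ)
    {k R : ℝ} {d : ℕ} (hR : k + (d + 2) * σ ≤ R)
    {f : MarkedConfig → ℝ} (hfm : Measurable f) {C : ℝ} (hC : 0 ≤ C) (hfC : ∀ ω, |f ω| ≤ C)
    (hfr : ∀ ω, f (PointConfig.restrict (window (Metric.ball (0 : V3) k)) ω) = f ω)
    {g : MarkedConfig → ℝ} (hgm : Measurable g) (hg2 : MemLp g 2 μ)
    (hgcyl : ∀ (n : ℕ) (x : Fin n → V3 × V3) (Y : MarkedConfig), g (superposeIn (Metric.ball (0 : V3) R) x Y) = g Y) :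
    |cov[f, g; μ]| ≤ 2 * C *
      (2 * ((Real.toNNReal z) • ((volume : Measure V3).prod ((volume : Measure V3).withDensity
            fun v => ENNReal.ofReal (maxwellianBeta β (v - u))))).real (window (Metric.ball (0 : V3) k)) *
          Real.exp (((Real.toNNReal z) • ((volume : Measure V3).prod ((volume : Measure V3).withDensity
            fun v => ENNReal.ofReal (maxwellianBeta β (v - u))))).real (window (Metric.ball (0 : V3) k))) *
          (2 * (8 * (z * σ ^ 3))) ^ d) * ∫ ω, |g ω| ∂μ := by
  haveI := hG.1
  have hΛ : MeasurableSet (Metric.ball (0 : V3) R) := Metric.isOpen_ball.measurableSet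
  have hb : Bornology.IsBounded (Metric.ball (0 : V3) R) := Metric.isBounded_ball
  set φ : ℝ := 2 * ((Real.toNNReal z) • ((volume : Measure V3).prod ((volume : Measure V3).withDensity
            fun v => ENNReal.ofReal (maxwellianBeta β (v - u))))).real (window (Metric.ball (0 : V3) k)) *
          Real.exp (((Real.toNNReal z) • ((volume : Measure V3).prod ((volume : Measure V3).withDensity
            fun v => ENNReal.ofReal (maxwellianBeta β (v - u))))).real (window (Metric.ball (0 : V3) k))) *
          (2 * (8 * (z * σ ^ 3))) ^ d with hφ
  have hφ0 : 0 ≤ φ := by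
    rw [hφ]
    refine mul_nonneg (mul_nonneg (mul_nonneg zero_le_two measureReal_nonneg) (Real.exp_nonneg _)) ?_
    exact pow_nonneg (by positivity) d
  have key := abs_cov_le_of_pinning (μ := μ) (gibbsSpecMeasure σ z β u (Metric.ball (0 : V3) R))
    (fun F hF => lintegral_eq_lintegral_gibbsSpecMeasure hG hΛ hb hF.aemeasurable)
    (S := {η : MarkedConfig | Literature.MathematicalPhysics.StatisticalMechanics.HardSphere.IsHardCore σ η})
    hG.ae_isHardCore hfm hC hfC (e := ENNReal.ofReal φ) ENNReal.ofReal_ne_top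
    (fun Y hY Y' hY' t => gibbsSpecMeasure_setOf_lt_le_add hσ hz hzσ hβ u hR hfm hfr hY hY' t) hgm hg2
    (fun ψ hψ Y F hF => lintegral_mul_comp_cylinder_gibbsSpecMeasure σ z β u hΛ hgm hgcyl hψ Y hF)
  rwa [ENNReal.toReal_ofReal hφ0] at key

/-- **Registered helper stub (part 1b of `stub_staticClustering`)**: the exponential `φ`-mixing covariance bound
`abs_cov_le_of_isHardSphereGibbs` of the dilute hard-sphere DLR state in closed form.
[cite: MichelenPerkins2021, Thm 3 and Thm 25] -/
theorem staticClustering_hardSphereMixing : ∀ (σ z β : ℝ), 0 < σ → 0 ≤ z → 16 * (z * σ ^ 3) < 1 → 0 < β → ∀ (u : V3) (μ : Measure MarkedConfig), IsHardSphereGibbs σ z β u μ → ∀ (k R : ℝ) (d : ℕ), k + (d + 2) * σ ≤ R → ∀ (f : MarkedConfig → ℝ), Measurable f → ∀ (C : ℝ), 0 ≤ C → (∀ ω, |f ω| ≤ C) → (∀ ω, f (PointConfig.restrict (Literature.MathematicalPhysics.StatisticalMechanics.HardSphere.window (Metric.ball (0 : V3) k)) ω) = f ω) → ∀ (g : MarkedConfig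 → ℝ), Measurable g → MemLp g 2 μ → (∀ (n : ℕ) (x : Fin n → V3 × V3) (Y : MarkedConfig), g (superposeIn (Metric.ball (0 : V3) R) x Y) = g Y) → |cov[f, g; μ]| ≤ 2 * C * (2 * ((Real.toNNReal z) • ((volume : Measure V3).prod ((volume : Measure V3).withDensity fun v => ENNReal.ofReal (Literature.Analysis.FunctionSpaces.maxwellianBeta β (v - u))))).real (Literature.MathematicalPhysics.StatisticalMechanics.HardSphere.window (Metric.ball (0 : V3) k)) * Real.exp (((Real.toNNReal z) • ((volume : Measure V3).prod ((volume : Measure V3).withDensity fun v => ENNReal.ofReal (Literature.Analysis.FunctionSpaces.maxwellianBeta β (v - u))))).real (Literature.MathematicalPhysics.StatisticalMechanics.HardSphere.window (Metric.ball (0 : V3) k))) * (2 * (8 * (z * σ ^ 3))) ^ d) * ∫ ω, |g ω| ∂μ :=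
  fun _σ _z _β hσ hz hzσ hβ _u _μ hG _k _R _d hR _f hfm _C hC hfC hfr _g hgm hg2 hgcyl =>
    abs_cov_le_of_isHardSphereGibbs hσ hz hzσ hβ hG hR hfm hC hfC hfr hgm hg2 hgcyl

end HardSphere

end Summit.AtomisticToContinuum.HydrodynamicLimit.Theorems.MourreKoopmanChargesStressStrongMixing

end
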